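import Literature.MathematicalPhysics.QuantumFieldTheory.Balaban1983to89.B9Thm313WholeLeafRelS
import Literature.MathematicalPhysics.QuantumFieldTheory.Balaban1983to89.B9Thm313WholeL2G

/-!
# `Balaban1983to89.B9Thm313WholeLeafRelSHL` — [B9] Theorem 3.13 (p. 426) AS THE WHOLE PRINTED LEAF `B9.Thm313Printed` AT THE PINS OF THEOREM 3.12 — the
# row-21 leaf with ALL SIX L² LINES (3.46) AND THE (3.43) LINE of 𝔊 PROVED INSIDE; the residual is the two input-Hölder lines (3.44), (3.45)

T. Bałaban, *Propagators for lattice gauge theories in a background field*, Commun. Math. Phys. **99** (1985) 389–434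
[`Balaban1985BackgroundPropagators`, "B9"]; [4] = T. Bałaban, *Propagators and renormalization transformations for lattice
gauge theories. II*, Commun. Math. Phys. **96** (1984) 223–250 [`Balaban1984PropagatorsII`].

statement-level skeleton of published theorems with citation tags; proofs where landed; nothing here is a claim about the
Yang–Mills mass gap

THE PRINTED LOCI are those of `…B9Thm313WholeLeafCoGlob`, `…B9Thm312WholeL2`, `…B9Thm313WholeHolder` and `…B9Thm313WholeL2G` (verbatim there).

WHY THIS FILE (successor of `…B9Thm313WholeLeafRelSH.thm313Printed_of_stepRelSH`, same seat).  The lines (3.46)₃,₄,₅ of 𝔊 — Δ_U𝔊, ∇_U𝔊∇\*_U,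
𝔊Δ_U in the block-L² norms, read relatively (n06-k `L2ReadsRel`) — are PROVED INSIDE from `B9Thm313WholeL2G.GG_l2bd_entry3∕4∕5` ((3.153) in
r1-g6's weighted block-L² classes: Theorem 3.3 (3.46) for G₀ `Thm33G0L2`, the step's L² bound `StepL2.t1`, the letters `Letters313L2`) and
n06-k's `l2line_of_blockBd_rel` (through `B9Thm312WholeBlocksRel.l2Block_of_blockBds_rel`).  The residual keeps (3.44) (`E4Block`) and (3.45)
(`H2Block`) of 𝔊 only.

WHAT THIS FILE PROVES (one public theorem + two private bookkeeping lemmas — 0 `def`, 0 named fact, 0 sorry): ★ `thm313Printed_of_stepRelSHL` —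
conclusion and pins of row 21 unchanged.

HONEST SCOPE.  Nothing of print is asserted: every analytic input is a HYPOTHESIS of printed ∕ definitional shape (located gap G-B9-16).  Kernel-checked
bookkeeping — NOT a node discharge, NOT summit progress; one finite lattice at a time; nothing continuum, nothing about the mass gap.  Cell `pub-ymgap`
(HUMAN RULING D-0062), Track A node N06 [B9], N06-ASSIGNMENT v1 row 21 (bundle F7), seat `pub-ymgap-dag-n06-l` (g4), 2026-08-27.
-/

namespace Literature.MathematicalPhysics.QuantumFieldTheory.Balaban1983to89.B9Thm313WholeLeafRelSHL

open Literature.MathematicalPhysics.QuantumFieldTheory.Balaban1983to89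
open Finset B6RandomWalk B6RandomWalkHom B9Thm34Ext B9Thm37GlueCor36 B11SectG B9SectDSup
open B9Thm37AllNorms B9Thm37AllNormsInstances B9FromB6 B9FromB6ModelSignsOn B9SectBStepWhole B9Thm312Whole B9Thm312WholeLeaf
open B9Thm312WholeLeft B9Thm313Whole B9Thm313WholeLeft B9Thm312WholeLeafLeftGlob B9Ineq347CoReading B9SectCDiffDict B9CoRealizesRel
open B9Thm37Glue B9SectDL2Decay B9RWSums343Holder B9RWSumsReadsRel B9Ineq347 B9Thm312WholeClasses B9Thm312WholeL2 B9Thm312WholeBlocksRel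
open B9Thm313WholeLeafRel B9Thm312WholeHolder B9Thm312WholeHHolder B9Thm313WholeHolder B9Thm313WholeLeafRelS B9Thm313WholeL2G

noncomputable section

section Family

variable {I : Type} {c35 : ℝ} {geo : I → B9.Geometry} {bg : I → B9.Backgrounds}
variable [∀ i, Fintype (geo i).Site] [∀ i, DecidableEq (geo i).Site]
variable {X Y Z W PX PY : I → Type} [∀ i, Fintype (X i)] [∀ i, DecidableEq (X i)] [∀ i, Fintype (Y i)]
  [∀ i, Fintype (Z i)] [∀ i, Fintype (W i)] [∀ i, Fintype (PX i)] [∀ i, Fintype (PY i)]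

omit [∀ i, Fintype (X i)] [∀ i, DecidableEq (X i)] [∀ i, Fintype (Y i)] [∀ i, Fintype (Z i)] [∀ i, Fintype (W i)]
  [∀ i, Fintype (geo i).Site] [∀ i, DecidableEq (geo i).Site] [∀ i, Fintype (PX i)] [∀ i, Fintype (PY i)] in
/-- Arithmetic of *"for α₀ sufficiently small"*: t ≧ 0 and m ≦ (2(t + 1))⁻¹ give tm ≦ ½. [folklore] -/
private theorem small_aux₈ {t m : ℝ} (ht : 0 ≤ t) (hm : m ≤ (2 * (t + 1))⁻¹) : t * m ≤ 1 / 2 := by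
  have hpos : 0 < 2 * (t + 1) := by linarith
  have h1 : t * m ≤ t * (2 * (t + 1))⁻¹ := mul_le_mul_of_nonneg_left hm ht
  have h2 : t * (2 * (t + 1))⁻¹ ≤ 1 / 2 := by
    rw [← div_eq_mul_inv, div_le_iff₀ hpos]
    linarith
  linarith




omit [∀ i, Fintype (X i)] [∀ i, DecidableEq (X i)] [∀ i, Fintype (Y i)] [∀ i, Fintype (Z i)] [∀ i, Fintype (W i)]
  [∀ i, Fintype (geo i).Site] [∀ i, DecidableEq (geo i).Site] [∀ i, Fintype (PX i)] [∀ i, Fintype (PY i)] in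
/-- `constH313` is monotone in every constant but B₃, c (for non-negative data). [cite: Balaban1985BackgroundPropagators, Thm 3.13 p.426 (bookkeeping)] -/
private theorem constH313_mono'' {CL CL' θ' θ'' A₁ A₁' A₃ A₃' B₃ Bd Bd' Bq Bq' κW κW' c : ℝ} (hL' : CL ≤ CL') (hθ : 0 ≤ θ')
    (hθ'' : θ' ≤ θ'') (h₁ : 0 ≤ A₁) (h₁' : A₁ ≤ A₁') (h₃ : 0 ≤ A₃) (h₃' : A₃ ≤ A₃') (hB : 0 ≤ B₃) (hd : 0 ≤ Bd) (hd' : Bd ≤ Bd')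
    (hq : 0 ≤ Bq) (hq' : Bq ≤ Bq') (hκ : 0 ≤ κW) (hκ' : κW ≤ κW') (hc : 0 ≤ c) :
    constH313 CL θ' A₁ A₃ B₃ Bd Bq κW c ≤ constH313 CL' θ'' A₁' A₃' B₃ Bd' Bq' κW' c := by
  unfold constH313
  have hθ''0 : 0 ≤ θ'' := hθ.trans hθ''
  have hA₃'0 : 0 ≤ A₃' := h₃.trans h₃'
  have hd'0 : 0 ≤ Bd' := hd.trans hd'
  have hκ'0 : 0 ≤ κW' := hκ.trans hκ'
  have hq'0 : 0 ≤ Bq' := hq.trans hq'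
  have e2 : κW * Bd * B₃ * c ≤ κW' * Bd' * B₃ * c := by gcongr
  have e3 : θ' * (A₃ * B₃ * c) * c ≤ θ'' * (A₃' * B₃ * c) * c := by gcongr
  have e4 : Bq * (B₃ * (B₃ * A₁ * c) * c) * c ≤ Bq' * (B₃ * (B₃ * A₁' * c) * c) * c := by gcongr
  have e5 : θ' * (A₃ * (B₃ * (B₃ * A₁ * c) * c) * c) * c ≤ θ'' * (A₃' * (B₃ * (B₃ * A₁' * c) * c) * c) * c := by gcongr
  linarith

omit [∀ i, DecidableEq (X i)] [∀ i, DecidableEq (geo i).Site] [∀ i, Fintype (PX i)] [∀ i, Fintype (PY i)] in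
/-- The three block-L² lines (3.46)₃,₄,₅ of 𝔊 at one member, from `B9Thm313WholeL2G.GG_l2bd_entry3∕4∕5` (inputs at the rate ρ, working rate ρ′,
ρ′ + 5σ ≦ ρ), brought to the family's uniform constant K₆ (through `constKp_le`, `constG46_mono`, the transfer constants below Λ_u) and rate δ_out
in the `pref6` shapes of `l2Block_of_blockBds_rel`. [cite: Balaban1985BackgroundPropagators, Thm 3.13 p.426 + (3.46) p.398 (bookkeeping)] -/
private theorem lines345_GG {i : I} (hG : GeoOK (geo i)) {𝔬 : Ops (geo i) (bg i) (X i) (Y i) (Z i) (W i)}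
    {Lap : (bg i).Cfg → Module.End ℝ (X i → ℝ)} {R₀ : ℝ} {H₀ : Prop} {U : (bg i).Cfg}
    {B₂ B₄ θ₂' t₂ ρ ρ' α σ c Λ₁ Λm Λu KGu K6 δout : ℝ} (hrow : RowSum (toB6 (geo i) R₀ H₀) σ c) (hB₂ : 0 ≤ B₂) (hB₄ : 0 ≤ B₄)
    (hc : 0 ≤ c) (hθ₂' : 0 ≤ θ₂') (hθ₂'le : θ₂' ≤ t₂) (hρ' : 0 < ρ') (hσ : 0 ≤ σ) (hρ'ρ₅ : ρ' + 5 * σ ≤ ρ)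
    (hq₂ : B₂ * θ₂' * c * c ≤ 1 / 2) (hST1 : ScaleTransfer (geo i) ρ' α Λ₁ (fun y => (geo i).len y ^ (1 : ℝ)))
    (hSTm : ScaleTransfer (geo i) ρ' α Λm (fun y => (geo i).len y ^ (-1 : ℝ))) (hΛ₁0 : 0 ≤ Λ₁) (hΛ₁le : Λ₁ ≤ Λu) (hΛm0 : 0 ≤ Λm)
    (hΛmle : Λm ≤ Λu) (h1Λu : 1 ≤ Λu) (hKGu0 : 0 ≤ KGu)
    (hKGle' : constG46 ((B₂ + B₄) + (B₂ + B₄) * (t₂ * (2 * (B₂ + B₄)) * c) * c) c ≤ KGu) (hK6G : KGu * Λu ≤ K6) (hKL0 : 0 ≤ K6)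
    (hδ1 : δout ≤ (1 - α) * ρ') (hδ2 : δout ≤ ρ') (hL : Thm33G0L2 𝔬 Lap R₀ H₀ B₂ ρ U)
    (hT : BlockBd (g := toB6 (geo i) R₀ H₀) 𝔬.blk 𝔬.blk (𝔬.Tpi U + 𝔬.T2 U)
      (fun (y y' : (geo i).Site) => θ₂' * ((geo i).len y)⁻¹ * ((geo i).len y')⁻¹ * Real.exp (-(ρ * (geo i).dist y y'))))
    (hLt : Letters313L2 𝔬 Lap R₀ H₀ B₄ ρ U) (hI : Identities 𝔬 U) :
    BlockBd (g := toB6 (geo i) R₀ H₀) 𝔬.blk 𝔬.blk (Lap U ∘ₗ 𝔬.GG U)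
        (fun (y y' : (geo i).Site) => K6 * B9.pref6 ((geo i).len y) 3 * Real.exp (-(δout * (geo i).dist y y'))) ∧
      BlockBd (g := toB6 (geo i) R₀ H₀) 𝔬.blkY 𝔬.blkY (𝔬.D U ∘ₗ (𝔬.GG U ∘ₗ 𝔬.Dstar U))
        (fun (y y' : (geo i).Site) => K6 * B9.pref6 ((geo i).len y) 4 * Real.exp (-(δout * (geo i).dist y y'))) ∧
      BlockBd (g := toB6 (geo i) R₀ H₀) 𝔬.blk 𝔬.blk (𝔬.GG U ∘ₗ Lap U)
        (fun (y y' : (geo i).Site) => K6 * B9.pref6 ((geo i).len y) 5 * Real.exp (-(δout * (geo i).dist y y'))) := by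
  have hq₂1 : B₂ * θ₂' * c * c < 1 := lt_one_of_le_half hq₂
  have hS0 : 0 ≤ B₂ + B₄ := add_nonneg hB₂ hB₄
  have hb4 := GG_l2bd_entry4 hG hrow hB₂ hB₄ hθ₂' hρ'.le hσ hρ'ρ₅ hL hT hLt hI hq₂1
  have hb3 := GG_l2bd_entry3 hG hrow hB₂ hB₄ hθ₂' hρ'.le hσ hρ'ρ₅ hST1 hL hT hLt hI hq₂1
  have hb5 := GG_l2bd_entry5 hG hrow hB₂ hB₄ hθ₂' hρ'.le hσ hρ'ρ₅ hSTm hL hT hLt hI hq₂1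
  have hρα : ρ' - α * ρ' = (1 - α) * ρ' := by ring
  rw [hρα] at hb3 hb5
  have hKp0 : 0 ≤ constKp B₂ B₄ θ₂' c := (constP_nonneg_le hθ₂' hc hq₂1 hS0 hS0 hS0 le_rfl le_rfl le_rfl).1
  have hKGle : constG46 (constKp B₂ B₄ θ₂' c) c ≤ KGu :=
    (constG46_mono hKp0 (constKp_le hB₂ hB₄ hθ₂' hθ₂'le hc hq₂) hc).trans hKGle'
  have hK3le : constG46 (constKp B₂ B₄ θ₂' c) c * Λ₁ ≤ K6 := (mul_le_mul hKGle hΛ₁le hΛ₁0 hKGu0).trans hK6G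
  have hK5le : constG46 (constKp B₂ B₄ θ₂' c) c * Λm ≤ K6 := (mul_le_mul hKGle hΛmle hΛm0 hKGu0).trans hK6G
  have hK4le : constG46 (constKp B₂ B₄ θ₂' c) c ≤ K6 :=
    hKGle.trans ((le_mul_of_one_le_right hKGu0 h1Λu).trans hK6G)
  have hexp : ∀ {r : ℝ}, δout ≤ r → ∀ y y' : (geo i).Site,
      Real.exp (-(r * (geo i).dist y y')) ≤ Real.exp (-(δout * (geo i).dist y y')) :=
    fun hr y y' => Real.exp_le_exp.mpr (neg_le_neg (mul_le_mul_of_nonneg_right hr (hG.dnn y y')))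
  have hP : ∀ t : ℝ, B9.pref6 t 3 = 1 ∧ B9.pref6 t 4 = 1 ∧ B9.pref6 t 5 = 1 := fun t => by simp [B9.pref6]
  refine ⟨hb3.mono fun y y' => ?_, hb4.mono fun y y' => ?_, hb5.mono fun y y' => ?_⟩
  · rw [(hP ((geo i).len y)).1, mul_one]
    exact mul_le_mul hK3le (hexp hδ1 y y') (Real.exp_nonneg _) hKL0
  · rw [(hP ((geo i).len y)).2.1, mul_one]
    exact mul_le_mul hK4le (hexp hδ2 y y') (Real.exp_nonneg _) hKL0
  · rw [(hP ((geo i).len y)).2.2, mul_one]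
    exact mul_le_mul hK5le (hexp hδ1 y y') (Real.exp_nonneg _) hKL0

/-- ★ **THEOREM 3.13 AS THE WHOLE PRINTED LEAF `B9.Thm313Printed`, AT THE PINS OF THEOREM 3.12 — ALL OF (3.46) AND (3.43) OF 𝔊 PROVED INSIDE** (p. 426).
Inputs: those of `B9Thm313WholeLeafRelSH.thm313Printed_of_stepRelSH` plus the Laplacian letters `Lap i`, Theorem 3.3 (3.46) for G₀ in the block-L² classes
(`hG0L2 : Thm33G0L2 … B₂ δ₀ U`), the step's block-L² bound (`hstepL2 : StepL2 … (θ₂·(Mα₀)) δ_K U`), the block-L² letters of the (3.153) pieces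
(`hLL2 : Letters313L2 … B₄ δ₃ U`), the relative L² co-readings of the lines 3, 4, 5 (`hl2R`, six members now), the numeric ρ′ + 5σ ≦ ρ (`hρ'ρ₅`);
the constant B₁ of the former residual is gone.  `hres` now displays ONLY (3.44) (`E4Block`) and (3.45) (`H2Block`) of 𝔊.  PROVED INSIDE: (3.42)₁,₂,₃,
(3.46)₀,…,₅ (n = 0, 1, 2 by Schur from the proved sup majorants; n = 3, 4, 5 by `GG_l2bd_entry3∕4∕5`), (3.43), (3.47)₀,₁,₂ of 𝔊, the pins; along the family
the a₀-restriction gains the L² smallness B₂θ₂(Mα₀)c² ≦ ½.  Nothing of print asserted; NOT a node discharge.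
[cite: Balaban1985BackgroundPropagators, Thm 3.13 p.426 + (3.152)–(3.153) p.426 + (3.138) p.423 + (3.41)–(3.43) pp.397–398 + (3.46)–(3.47) p.398; Balaban1984PropagatorsII, (2.51)–(2.52) p.232 + Lemma 2.1 (2.60)–(2.61) p.234] -/
theorem thm313Printed_of_stepRelSHL (𝔬 : ∀ i, Ops (geo i) (bg i) (X i) (Y i) (Z i) (W i)) (R₀ : I → ℝ) (H₀ : I → Prop)
    (GG : ∀ i, B9.KernelFamily (geo i) (bg i)) (bH : ∀ i, BlockNorm (toB6 (geo i) (R₀ i) (H₀ i)) (W i → ℝ))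
    (𝔭 : ∀ i, HolderProbes (geo i) (bg i) (X i) (Y i) (PX i) (PY i))
    (bHY : ∀ i, ℝ → BlockNorm (toB6 (geo i) (R₀ i) (H₀ i)) (Y i → ℝ)) (Lap : ∀ i, (bg i).Cfg → Module.End ℝ (X i → ℝ))
    (ev : ∀ i, (geo i).Loc → X i → ℝ) (evY : ∀ i, (geo i).Loc → Y i → ℝ) {P : ∀ i, (geo i).Loc → Prop}
    (Rel : ∀ i, (geo i).Site → (geo i).Site → Prop) [∀ i, DecidableRel (Rel i)] (m : ℕ)
    (θ₁ θD θH θ₂ r₁ B₀ B₂ B₄ δ₀ δK σ c ρ a₁ M₁ ML δ₁ B₃ δ₃ ρ' α Lc κ₀ : ℝ) (Bε Bh Bi Bq BhD Bx : ℝ → ℝ) (Bεβ Bi2 : ℝ → ℝ → ℝ)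
    (hθ₁ : 0 ≤ θ₁) (hθD : 0 ≤ θD) (hθH : 0 ≤ θH) (hθ₂ : 0 ≤ θ₂) (hr₁ : 0 ≤ r₁) (hB₀ : 0 ≤ B₀) (hB₂ : 0 ≤ B₂) (hB₃ : 0 ≤ B₃)
    (hB₄ : 0 ≤ B₄) (hσ : 0 ≤ σ) (hρ' : 0 < ρ') (hρ'ρ : ρ' + 3 * σ ≤ ρ) (hρ'ρ₅ : ρ' + 5 * σ ≤ ρ)
    (hρS : ρ ≤ δ₀) (hρ₃ : ρ ≤ δ₃) (hρδ : ρ + σ ≤ δK) (hc : 0 ≤ c) (ha₁ : 0 < a₁) (hM₁ : 0 < M₁) (hδ₁ : 0 < δ₁)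
    (hα0 : 0 ≤ α) (hα1 : α < 1) (hBε : ∀ ε, 0 ≤ Bε ε) (hBεβ : ∀ ε β, 0 ≤ Bεβ ε β)
    (hBh : ∀ β, 0 ≤ β → β < 1 → 0 ≤ Bh β) (hBq : ∀ β, 0 ≤ β → β < 1 → 0 ≤ Bq β) (hBhD : ∀ β, 0 ≤ β → β < 1 → 0 ≤ BhD β)
    (hBx : ∀ β, 0 ≤ β → β < 1 → 0 ≤ Bx β)
    (hgeo : ∀ i, GeoOK (geo i)) (S : ∀ i, ModelSignsOn (geo i) (P i))
    (hL1 : ∀ i, 1 ≤ (geo i).L) (hLle : ∀ i, (geo i).L ≤ Lc) (hη : ∀ i, 0 < (geo i).eta) (hκ : ∀ i, (bH i).κ ≤ κ₀)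
    (hrow : ∀ i, ML ≤ (geo i).M → RowSum (toB6 (geo i) (R₀ i) (H₀ i)) σ c)
    (hL21 : ∀ δ : ℝ, 0 < δ → ∃ ML' c' : ℝ, Lemma21AboveG geo R₀ H₀ δ α ML' c')
    (hsat : ∀ (i : I) (n : Fin 4) (B' δ' : ℝ),
      (∀ a a' b, Rel i a a' → maj342 (geo i) n B' δ' a b = maj342 (geo i) n B' δ' a' b) ∧
      (∀ a b b', Rel i b b' → maj342 (geo i) n B' δ' a b = maj342 (geo i) n B' δ' a b'))
    (hmult : ∀ (i : I) (y' : (geo i).Site), (Finset.univ.filter (fun y'' => Rel i y'' y')).card ≤ m)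
    (hcoR : ∀ (i : I) (U : (bg i).Cfg),
      CoRealizesRel (GG i) 0 U (Rel i) (𝔬 i).blk (𝔬 i).blk (ev i) ((𝔬 i).GG U) ∧
      CoRealizesRel (GG i) 2 U (Rel i) (𝔬 i).blk (𝔬 i).blkY (evY i) ((𝔬 i).GG U ∘ₗ (𝔬 i).Dstar U))
    (hco1R : ∀ (i : I) (U : (bg i).Cfg), CoRealizesRel (GG i) 1 U (Rel i) (𝔬 i).blkY (𝔬 i).blk (ev i) ((𝔬 i).D U ∘ₗ (𝔬 i).GG U))
    (hcoG : ∀ (i : I) (U : (bg i).Cfg),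
      CoReadsGlob (GG i) 0 U (𝔬 i).blk (𝔬 i).blk (ev i) ((𝔬 i).GG U) ∧
      CoReadsGlob (GG i) 1 U (𝔬 i).blkY (𝔬 i).blk (ev i) ((𝔬 i).D U ∘ₗ (𝔬 i).GG U) ∧
      CoReadsGlob (GG i) 2 U (𝔬 i).blk (𝔬 i).blkY (evY i) ((𝔬 i).GG U ∘ₗ (𝔬 i).Dstar U))
    (hsymGG : ∀ (i : I) (U : (bg i).Cfg), IsTransposePair ((𝔬 i).GG U) ((𝔬 i).GG U))
    (htrGG : ∀ (i : I) (U : (bg i).Cfg), IsTransposePair ((𝔬 i).D U ∘ₗ (𝔬 i).GG U) ((𝔬 i).GG U ∘ₗ (𝔬 i).Dstar U))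
    (hl2R : ∀ (i : I) (U : (bg i).Cfg),
      L2ReadsRel (R := R₀ i) (H := H₀ i) (GG i) 0 U (Rel i) (𝔬 i).blk (𝔬 i).blk (ev i) ((𝔬 i).GG U) ∧
      L2ReadsRel (R := R₀ i) (H := H₀ i) (GG i) 1 U (Rel i) (𝔬 i).blkY (𝔬 i).blk (ev i) ((𝔬 i).D U ∘ₗ (𝔬 i).GG U) ∧
      L2ReadsRel (R := R₀ i) (H := H₀ i) (GG i) 2 U (Rel i) (𝔬 i).blk (𝔬 i).blkY (evY i) ((𝔬 i).GG U ∘ₗ (𝔬 i).Dstar U) ∧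
      L2ReadsRel (R := R₀ i) (H := H₀ i) (GG i) 3 U (Rel i) (𝔬 i).blk (𝔬 i).blk (ev i) (Lap i U ∘ₗ (𝔬 i).GG U) ∧
      L2ReadsRel (R := R₀ i) (H := H₀ i) (GG i) 4 U (Rel i) (𝔬 i).blkY (𝔬 i).blkY (evY i)
        ((𝔬 i).D U ∘ₗ ((𝔬 i).GG U ∘ₗ (𝔬 i).Dstar U)) ∧
      L2ReadsRel (R := R₀ i) (H := H₀ i) (GG i) 5 U (Rel i) (𝔬 i).blk (𝔬 i).blk (ev i) ((𝔬 i).GG U ∘ₗ Lap i U))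
    (hH1R : ∀ (i : I) (U : (bg i).Cfg),
      H1ReadsRel (GG i) U (𝔭 i) (Rel i) (𝔬 i).blk (𝔬 i).blkY (ev i) (evY i) ((𝔬 i).D U ∘ₗ (𝔬 i).GG U)
        ((𝔬 i).GG U ∘ₗ (𝔬 i).Dstar U))
    (hRdist : ∀ (i : I) (a a' b : (geo i).Site), Rel i a a' → (geo i).dist a b = (geo i).dist a' b)
    (hRdist' : ∀ (i : I) (a b b' : (geo i).Site), Rel i b b' → (geo i).dist a b = (geo i).dist a b')
    (hRlen : ∀ (i : I) (a a' : (geo i).Site), Rel i a a' → (geo i).len a = (geo i).len a')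
    (hmodel : ∀ i, M₁ ≤ (geo i).M → ∀ α₀ : ℝ, 0 < α₀ → (geo i).M * α₀ ≤ a₁ →
      ∀ U : (bg i).Cfg, (bg i).Reg335 c35 α₀ U → (bg i).Reg336 c35 α₀ U →
        Thm33G0 (𝔬 i) (R₀ i) (H₀ i) B₀ δ₀ U ∧
        Step (𝔬 i) (R₀ i) (H₀ i) (hgeo i).lenle 1 (θ₁ * ((geo i).M * α₀)) δK U ∧
        Step (𝔬 i) (R₀ i) (H₀ i) (hgeo i).lenle 2 (θ₁ * ((geo i).M * α₀)) δK U ∧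
        FormSmall (𝔬 i) (r₁ * ((geo i).M * α₀)) U ∧ Identities (𝔬 i) U)
    (hleft : ∀ i, M₁ ≤ (geo i).M → ∀ α₀ : ℝ, 0 < α₀ → (geo i).M * α₀ ≤ a₁ →
      ∀ U : (bg i).Cfg, (bg i).Reg335 c35 α₀ U → (bg i).Reg336 c35 α₀ U →
        LeftStep (𝔬 i) (R₀ i) (H₀ i) (hgeo i).lenle B₀ δ₀ (θD * ((geo i).M * α₀)) δK U)
    (hletters : ∀ i, M₁ ≤ (geo i).M → ∀ α₀ : ℝ, 0 < α₀ → (geo i).M * α₀ ≤ a₁ →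
      ∀ U : (bg i).Cfg, (bg i).Reg335 c35 α₀ U → (bg i).Reg336 c35 α₀ U →
        Letters313 (𝔬 i) (R₀ i) (H₀ i) (hgeo i) B₃ δ₃ U)
    (hlettersD : ∀ i, M₁ ≤ (geo i).M → ∀ α₀ : ℝ, 0 < α₀ → (geo i).M * α₀ ≤ a₁ →
      ∀ U : (bg i).Cfg, (bg i).Reg335 c35 α₀ U → (bg i).Reg336 c35 α₀ U →
        Letters313D (𝔬 i) (R₀ i) (H₀ i) (hgeo i) B₃ δ₃ (bH i) U)
    (hG0H : ∀ i, M₁ ≤ (geo i).M → ∀ α₀ : ℝ, 0 < α₀ → (geo i).M * α₀ ≤ a₁ →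
      ∀ U : (bg i).Cfg, (bg i).Reg335 c35 α₀ U → (bg i).Reg336 c35 α₀ U →
        Thm33G0H (𝔬 i) (𝔭 i) (R₀ i) (H₀ i) (bHY i) Bh Bi Bi2 δ₀ U)
    (hstepH : ∀ i, M₁ ≤ (geo i).M → ∀ α₀ : ℝ, 0 < α₀ → (geo i).M * α₀ ≤ a₁ →
      ∀ U : (bg i).Cfg, (bg i).Reg335 c35 α₀ U → (bg i).Reg336 c35 α₀ U →
        StepH (𝔬 i) (𝔭 i) (R₀ i) (H₀ i) (bHY i) (hgeo i).lenle (θH * ((geo i).M * α₀)) δK U)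
    (hLHH : ∀ i, M₁ ≤ (geo i).M → ∀ α₀ : ℝ, 0 < α₀ → (geo i).M * α₀ ≤ a₁ →
      ∀ U : (bg i).Cfg, (bg i).Reg335 c35 α₀ U → (bg i).Reg336 c35 α₀ U →
        LettersHH (𝔬 i) (𝔭 i) (R₀ i) (H₀ i) (hgeo i).lenle Bq δ₃ U)
    (hLH3 : ∀ i, M₁ ≤ (geo i).M → ∀ α₀ : ℝ, 0 < α₀ → (geo i).M * α₀ ≤ a₁ →
      ∀ U : (bg i).Cfg, (bg i).Reg335 c35 α₀ U → (bg i).Reg336 c35 α₀ U →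
        Letters313H (𝔬 i) (𝔭 i) (R₀ i) (H₀ i) (hgeo i).lenle (bH i) BhD Bx δ₃ U)
    (hG0L2 : ∀ i, M₁ ≤ (geo i).M → ∀ α₀ : ℝ, 0 < α₀ → (geo i).M * α₀ ≤ a₁ →
      ∀ U : (bg i).Cfg, (bg i).Reg335 c35 α₀ U → (bg i).Reg336 c35 α₀ U →
        Thm33G0L2 (𝔬 i) (Lap i) (R₀ i) (H₀ i) B₂ δ₀ U)
    (hstepL2 : ∀ i, M₁ ≤ (geo i).M → ∀ α₀ : ℝ, 0 < α₀ → (geo i).M * α₀ ≤ a₁ →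
      ∀ U : (bg i).Cfg, (bg i).Reg335 c35 α₀ U → (bg i).Reg336 c35 α₀ U →
        StepL2 (𝔬 i) (R₀ i) (H₀ i) (θ₂ * ((geo i).M * α₀)) δK U)
    (hLL2 : ∀ i, M₁ ≤ (geo i).M → ∀ α₀ : ℝ, 0 < α₀ → (geo i).M * α₀ ≤ a₁ →
      ∀ U : (bg i).Cfg, (bg i).Reg335 c35 α₀ U → (bg i).Reg336 c35 α₀ U →
        Letters313L2 (𝔬 i) (Lap i) (R₀ i) (H₀ i) B₄ δ₃ U)
    (hres : ∀ i, M₁ ≤ (geo i).M → ∀ α₀ : ℝ, 0 < α₀ → (geo i).M * α₀ ≤ a₁ →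
      ∀ U : (bg i).Cfg, (bg i).Reg335 c35 α₀ U → (bg i).Reg336 c35 α₀ U →
        E4Block (GG i) Bε δ₁ U ∧ H2Block (GG i) Bεβ δ₁ U) :
    B9.Thm313Printed c35 geo bg GG (fun i => HasRWExpOfOps (𝔬 i)) (fun i => PosDefKOfOps (𝔬 i)) := by
  -- the constants of the leaf
  obtain ⟨MLg, cg, hLg⟩ := hL21 ρ' hρ'
  set cg' : ℝ := max cg 0 with hcg'
  have hcg'0 : 0 ≤ cg' := le_max_right _ _
  set a₀ : ℝ := min a₁ (min (2 * (θ₁ * c + 1))⁻¹ (min (2 * (r₁ + 1))⁻¹ (2 * (B₂ * θ₂ * c * c + 1))⁻¹)) with ha₀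
  set C₂ : ℝ := const313 (2 * B₀) (2 * B₃) B₃ c with hC₂
  set CD : ℝ := constD313 (B₀ + θD * a₁ * (2 * B₀) * c) (θD * a₁) (2 * B₀) (2 * B₃) B₃ (max κ₀ 0) c with hCD
  set Csup : ℝ := max C₂ CD with hCsup
  set CsupR : ℝ := (m : ℝ) * Csup with hCsupR
  set Cgl : ℝ := Csup * cg' * Lc ^ (4 : ℝ) with hCgl
  set Λu : ℝ := Lc ^ (4 : ℝ) with hΛu
  set KpU : ℝ := (B₂ + B₄) + (B₂ + B₄) * (θ₂ * a₁ * (2 * (B₂ + B₄)) * c) * c with hKpU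
  set KGu : ℝ := constG46 KpU c with hKGu
  set K6 : ℝ := (Csup + KGu) * Λu with hK6
  set BL2S : ℝ := (m : ℝ) * m * K6 with hBL2S
  set Bout : ℝ := max (max (max CsupR Cgl) BL2S) 1 with hBout
  set δout : ℝ := min ((1 - α) * ρ') δ₁ with hδout
  set tH : ℝ := θH * a₁ with htH
  set Cu : ℝ → ℝ := fun β => constH313 (Bh β + tH * (2 * B₀) * c) tH (2 * B₀) (2 * B₃) B₃ (max (BhD β) (Bx β)) (max (Bq β) (Bx β))
    (max κ₀ 1) c with hCu
  set Bβo : ℝ → ℝ := fun β => max ((m : ℝ) * Cu β) 0 with hBβo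
  have hBβo0 : ∀ β, 0 ≤ Bβo β := fun β => le_max_right _ _
  have htH0 : 0 ≤ tH := mul_nonneg hθH ha₁.le
  have hθc : 0 ≤ θ₁ * c := mul_nonneg hθ₁ hc
  have hB₂c : 0 ≤ B₂ * θ₂ * c * c := mul_nonneg (mul_nonneg (mul_nonneg hB₂ hθ₂) hc) hc
  have ha₀pos : 0 < a₀ :=
    lt_min ha₁ (lt_min (inv_pos.mpr (mul_pos two_pos (add_pos_of_nonneg_of_pos hθc one_pos)))
      (lt_min (inv_pos.mpr (mul_pos two_pos (add_pos_of_nonneg_of_pos hr₁ one_pos)))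
        (inv_pos.mpr (mul_pos two_pos (add_pos_of_nonneg_of_pos hB₂c one_pos)))))
  have hS0 : 0 ≤ B₂ + B₄ := add_nonneg hB₂ hB₄
  have hKpU0 : 0 ≤ KpU :=
    add_nonneg hS0 (mul_nonneg (mul_nonneg hS0 (mul_nonneg (mul_nonneg (mul_nonneg hθ₂ ha₁.le) (mul_nonneg zero_le_two hS0)) hc)) hc)
  have hKGu0 : 0 ≤ KGu := constG46_nonneg hKpU0 hc
  have hC₂0 : 0 ≤ C₂ := const313_nonneg (mul_nonneg zero_le_two hB₀) (mul_nonneg zero_le_two hB₃) hB₃ hc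
  have hCsup2 : C₂ ≤ Csup := le_max_left _ _
  have hCsupD : CD ≤ Csup := le_max_right _ _
  have hCsup0 : 0 ≤ Csup := hC₂0.trans hCsup2
  have hCsupR0 : 0 ≤ CsupR := mul_nonneg (Nat.cast_nonneg m) hCsup0
  have hBoutS : CsupR ≤ Bout := ((le_max_left _ _).trans (le_max_left _ _)).trans (le_max_left _ _)
  have hBoutG : Cgl ≤ Bout := ((le_max_right _ _).trans (le_max_left _ _)).trans (le_max_left _ _)
  have hBoutL : BL2S ≤ Bout := (le_max_right _ _).trans (le_max_left _ _)
  have hBout0 : 0 ≤ Bout := zero_le_one.trans (le_max_right _ _)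
  have h1α : 0 < 1 - α := sub_pos.mpr hα1
  have hαρ : 0 ≤ α * ρ' := mul_nonneg hα0 hρ'.le
  have hδρ1 : δout ≤ (1 - α) * ρ' := min_le_left _ _
  have hδρ : δout ≤ ρ' := hδρ1.trans (by rw [sub_mul, one_mul]; exact sub_le_self _ (mul_nonneg hα0 hρ'.le))
  have hδδ₁ : δout ≤ δ₁ := min_le_right _ _
  refine ⟨max (max M₁ ML) MLg, δout, a₀, Bout, Bβo, Bε, Bεβ, lt_max_of_lt_left (lt_max_of_lt_left hM₁), lt_min (mul_pos h1α hρ') hδ₁,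
    ha₀pos, zero_lt_one.trans_le (le_max_right _ _), ?_⟩
  intro i hM α₀ hα₀ hMa U hU hU'
  have hM₁i : M₁ ≤ (geo i).M := ((le_max_left _ _).trans (le_max_left _ _)).trans hM
  have hMLi : ML ≤ (geo i).M := ((le_max_right _ _).trans (le_max_left _ _)).trans hM
  have hMLgi : MLg ≤ (geo i).M := (le_max_right _ _).trans hM
  have hMpos : 0 < (geo i).M := hM₁.trans_le hM₁i
  have hm0 : 0 ≤ (geo i).M * α₀ := (mul_pos hMpos hα₀).le
  have hma₁ : (geo i).M * α₀ ≤ a₁ := hMa.trans (min_le_left _ _)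
  have hmθ : (geo i).M * α₀ ≤ (2 * (θ₁ * c + 1))⁻¹ := hMa.trans ((min_le_right _ _).trans (min_le_left _ _))
  have hmr : (geo i).M * α₀ ≤ (2 * (r₁ + 1))⁻¹ := hMa.trans ((min_le_right _ _).trans ((min_le_right _ _).trans (min_le_left _ _)))
  have hm₂ : (geo i).M * α₀ ≤ (2 * (B₂ * θ₂ * c * c + 1))⁻¹ :=
    hMa.trans ((min_le_right _ _).trans ((min_le_right _ _).trans (min_le_right _ _)))
  obtain ⟨h33, hS1, hS2, hF, hI⟩ := hmodel i hM₁i α₀ hα₀ hma₁ U hU hU'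
  have hL := hletters i hM₁i α₀ hα₀ hma₁ U hU hU'
  have hLD := hlettersD i hM₁i α₀ hα₀ hma₁ U hU hU'
  have hLS := hleft i hM₁i α₀ hα₀ hma₁ U hU hU'
  obtain ⟨h344, h345⟩ := hres i hM₁i α₀ hα₀ hma₁ U hU hU'
  have hL2s := hG0L2 i hM₁i α₀ hα₀ hma₁ U hU hU'
  have hStL := hstepL2 i hM₁i α₀ hα₀ hma₁ U hU hU'
  have hLt := hLL2 i hM₁i α₀ hα₀ hma₁ U hU hU'
  have hH0 := hG0H i hM₁i α₀ hα₀ hma₁ U hU hU'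
  have hStH := hstepH i hM₁i α₀ hα₀ hma₁ U hU hU'
  have hHH := hLHH i hM₁i α₀ hα₀ hma₁ U hU hU'
  have hH3 := hLH3 i hM₁i α₀ hα₀ hma₁ U hU hU'
  have hH1 := hH1R i U
  obtain ⟨hlR0, hlR1, hlR2, hlR3, hlR4, hlR5⟩ := hl2R i U
  have hrowi := hrow i hMLi
  obtain ⟨h260, hrowg, hsize⟩ := hLg i hMLgi
  have hrowg' : RowSum (toB6 (geo i) (R₀ i) (H₀ i)) ((1 - α) * ρ') cg' := fun y => (hrowg y).trans (le_max_left _ _)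
  set θ : ℝ := θ₁ * ((geo i).M * α₀) with hθdef
  set θ' : ℝ := θD * ((geo i).M * α₀) with hθ'def
  set θ₂' : ℝ := θ₂ * ((geo i).M * α₀) with hθ₂'def
  have hθ : 0 ≤ θ := mul_nonneg hθ₁ hm0
  have hθ' : 0 ≤ θ' := mul_nonneg hθD hm0
  have hθ₂' : 0 ≤ θ₂' := mul_nonneg hθ₂ hm0
  have hθ₂'le : θ₂' ≤ θ₂ * a₁ := mul_le_mul_of_nonneg_left hma₁ hθ₂
  have hq₂ : B₂ * θ₂' * c * c ≤ 1 / 2 := by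
    have h := small_aux₈ hB₂c hm₂
    calc B₂ * θ₂' * c * c = B₂ * θ₂ * c * c * ((geo i).M * α₀) := by rw [hθ₂'def]; ring
      _ ≤ 1 / 2 := h
  have hq₂1 : B₂ * θ₂' * c * c < 1 := lt_one_of_le_half hq₂
  have hq : θ * c ≤ 1 / 2 := by
    have h := small_aux₈ (mul_nonneg hθ₁ hc) hmθ
    calc θ * c = θ₁ * c * ((geo i).M * α₀) := by rw [hθdef]; ring
      _ ≤ 1 / 2 := h
  have hq1 : θ * c < 1 := lt_one_of_le_half hq
  have hr : r₁ * ((geo i).M * α₀) < 1 := by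
    have h := small_aux₈ hr₁ hmr
    linarith only [h]
  have hρ0 : 0 ≤ ρ := (add_nonneg hρ'.le (mul_nonneg zero_le_three hσ)).trans hρ'ρ
  have hσδ : σ ≤ δK := (le_add_of_nonneg_left hρ0).trans hρδ
  have hinv0 : 0 ≤ (1 - θ * c)⁻¹ := inv_nonneg.mpr (by linarith only [hq])
  have hA₁ : 0 ≤ B₀ * (1 - θ * c)⁻¹ := mul_nonneg hB₀ hinv0
  have hA₃ : 0 ≤ B₃ * (1 - θ * c)⁻¹ := mul_nonneg hB₃ hinv0
  have hA₁le : B₀ * (1 - θ * c)⁻¹ ≤ 2 * B₀ := const_le_two_mul hB₀ hq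
  have hA₃le : B₃ * (1 - θ * c)⁻¹ ≤ 2 * B₃ := const_le_two_mul hB₃ hq
  have hC0 : 0 ≤ const313 (B₀ * (1 - θ * c)⁻¹) (B₃ * (1 - θ * c)⁻¹) B₃ c := const313_nonneg hA₁ hA₃ hB₃ hc
  have hCle : const313 (B₀ * (1 - θ * c)⁻¹) (B₃ * (1 - θ * c)⁻¹) B₃ c ≤ Csup :=
    (const313_mono hA₁ hA₁le hA₃ hA₃le hB₃ hc).trans hCsup2
  -- the constant of the left entry
  have hCL : 0 ≤ B₀ + θ' * (B₀ * (1 - θ * c)⁻¹) * c := add_nonneg hB₀ (mul_nonneg (mul_nonneg hθ' hA₁) hc)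
  have hθ'le : θ' ≤ θD * a₁ := mul_le_mul_of_nonneg_left hma₁ hθD
  have hCLle : B₀ + θ' * (B₀ * (1 - θ * c)⁻¹) * c ≤ B₀ + θD * a₁ * (2 * B₀) * c := by
    have h2 : θ' * (B₀ * (1 - θ * c)⁻¹) ≤ θD * a₁ * (2 * B₀) := mul_le_mul hθ'le hA₁le hA₁ (mul_nonneg hθD ha₁.le)
    have h3 : θ' * (B₀ * (1 - θ * c)⁻¹) * c ≤ θD * a₁ * (2 * B₀) * c := mul_le_mul_of_nonneg_right h2 hc
    linarith only [h3]
  have hD0 : 0 ≤ constD313 (B₀ + θ' * (B₀ * (1 - θ * c)⁻¹) * c) θ' (B₀ * (1 - θ * c)⁻¹) (B₃ * (1 - θ * c)⁻¹) B₃ (bH i).κ c :=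
    constD313_nonneg hCL hθ' hA₁ hA₃ hB₃ (bH i).κ_nonneg hc
  have hDle : constD313 (B₀ + θ' * (B₀ * (1 - θ * c)⁻¹) * c) θ' (B₀ * (1 - θ * c)⁻¹) (B₃ * (1 - θ * c)⁻¹) B₃ (bH i).κ c ≤
      Csup :=
    (constD313_mono hCLle hθ' hθ'le hA₁ hA₁le hA₃ hA₃le hB₃ ((hκ i).trans (le_max_left _ _)) hc).trans hCsupD
  obtain ⟨hco0, hco2⟩ := hcoR i U
  have hco1i := hco1R i U
  obtain ⟨hg0, hg1, hg2⟩ := hcoG i U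
  have hlen := (hgeo i).lenle
  -- the model majorants of 𝔊 at the rate ρ′
  have hm0 := GG_entry0_of_letters (hgeo i) hrowi hc hθ hB₀ hB₃ hσ hρ'.le hρ'ρ hρS hρ₃ hρδ hq1 hS2.step1 h33.e0 hL hI
  have hm1 := GG_entry1_of_letters (hgeo i) hrowi hc hθ hθ' hB₀ hB₃ hσ hρ'.le hρ'ρ hρS hρ₃ hρδ hq1 hS2.step1 h33.e0 hLS hL hLD hI
  have hm2 := GG_entry2_of_letters (hgeo i) hrowi hc hθ hB₀ hB₃ hσ hρ'.le hρ'ρ hρS hρ₃ hρδ hq1 hS1.step1 h33.e2 hL hI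
  -- the same majorants in the `maj342 · n Csup ρ′` shape, for the (3.47) passage on the model lattice
  have hM0 : HasMajorantHom (g := toB6 (geo i) (R₀ i) (H₀ i)) (𝔬 i).blk (𝔬 i).blk ((𝔬 i).GG U) (maj342 (geo i) 0 Csup ρ') :=
    hasMajorantHom_maj342_zero_of_le ((hasMajorantHom_iff (g := toB6 (geo i) (R₀ i) (H₀ i)) (𝔬 i).blk _ _).2 hm0) hCle
  have hM1 : HasMajorantHom (g := toB6 (geo i) (R₀ i) (H₀ i)) (𝔬 i).blk (𝔬 i).blkY ((𝔬 i).D U ∘ₗ (𝔬 i).GG U) (maj342 (geo i) 1 Csup ρ') :=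
    hasMajorantHom_maj342_one_of_le hm1 hDle hlen
  have hM2 : HasMajorantHom (g := toB6 (geo i) (R₀ i) (H₀ i)) (𝔬 i).blkY (𝔬 i).blk ((𝔬 i).GG U ∘ₗ (𝔬 i).Dstar U) (maj342 (geo i) 2 Csup ρ') :=
    hasMajorantHom_maj342_two_of_le hm2 hCle hlen
  -- the proved clauses (3.42)₁,₂,₃ of 𝔊 at the rate ρ′ with the constant m·Csup, through the RELATIVE co-readings
  have cl0 : Clause342 (GG i) 0 CsupR ρ' U :=
    clause342_of_hasMajorantHom_rel hco0 hCsup0 hlen (hsat i 0 Csup ρ').1 (hsat i 0 Csup ρ').2 (hmult i) hM0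
  have cl1 : Clause342 (GG i) 1 CsupR ρ' U :=
    clause342_of_hasMajorantHom_rel hco1i hCsup0 hlen (hsat i 1 Csup ρ').1 (hsat i 1 Csup ρ').2 (hmult i) hM1
  have cl2 : Clause342 (GG i) 2 CsupR ρ' U :=
    clause342_of_hasMajorantHom_rel hco2 hCsup0 hlen (hsat i 2 Csup ρ').1 (hsat i 2 Csup ρ').2 (hmult i) hM2
  -- the global entries (3.47)₀,₁,₂ of 𝔊, constant Csup·c′·L⁴ ≦ Bout
  have hL0i : 0 < (geo i).L := lt_of_lt_of_le one_pos (hL1 i)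
  have hL4 : (geo i).L ^ (4 : ℝ) ≤ Lc ^ (4 : ℝ) := Real.rpow_le_rpow hL0i.le (hLle i) (by norm_num)
  have hCgl0 : 0 ≤ Csup * cg' * (geo i).L ^ (4 : ℝ) := mul_nonneg (mul_nonneg hCsup0 hcg'0) (Real.rpow_nonneg hL0i.le _)
  have hCglle : Csup * cg' * (geo i).L ^ (4 : ℝ) ≤ Bout := (mul_le_mul_of_nonneg_left hL4 (mul_nonneg hCsup0 hcg'0)).trans hBoutG
  have hglob : ∀ (n : Fin 4) (lam : (geo i).Loc) (γ : ℝ), n ≠ 3 → -4 ≤ γ → γ ≤ 4 →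
      (GG i).glob n U lam γ ≤ Bout * (geo i).wNorm γ lam :=
    glob_noLap_of_entries (PG := fun _ => True) (S i) hCgl0 hCgl0 hCgl0 hCglle hCglle hCglle
      (fun lam γ _ => glob_of_hasMajorantHom hg0 hM0 hCsup0 hcg'0 (hL1 i) (hη i) (S i).wNorm_nonneg hsize h260 hrowg' lam γ)
      (fun lam γ _ => glob_of_hasMajorantHom hg1 hM1 hCsup0 hcg'0 (hL1 i) (hη i) (S i).wNorm_nonneg hsize h260 hrowg' lam γ)
      (fun lam γ _ => glob_of_hasMajorantHom hg2 hM2 hCsup0 hcg'0 (hL1 i) (hη i) (S i).wNorm_nonneg hsize h260 hrowg' lam γ)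
      (fun _ _ _ h => absurd trivial h)
  -- everything brought to (Bout, δout)
  have w : ∀ {j : Fin 4}, Clause342 (GG i) j CsupR ρ' U → Clause342 (GG i) j Bout δout U := fun cm =>
    clause342_mono cm hCsupR0 hBoutS hδρ (S i).dist_nonneg hlen (S i).supNorm_nonneg
  -- the L² lines (3.46)₀,₁,₂ of 𝔊 by the Schur test from the three sup majorants, the transposition letters and the scale transfer
  have hm00 : (0 : ℝ) ≤ m := Nat.cast_nonneg m
  have hΛu0 : 0 ≤ Λu := Real.rpow_nonneg (hL0i.le.trans (hLle i)) _
  have hST : ∀ γ : ℝ, |γ| ≤ 4 → ScaleTransfer (geo i) ρ' α ((geo i).L ^ |γ|) (fun y => (geo i).len y ^ γ) ∧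
      0 ≤ (geo i).L ^ |γ| ∧ (geo i).L ^ |γ| ≤ Λu := fun γ hγ =>
    ⟨scaleTransfer_rpow_of_260 h260 hsize (hL1 i) (hη i) γ hγ, Real.rpow_nonneg hL0i.le _,
      (B9Ineq347AllEntries.size_condition_compact (geo i).L γ _ (hL1 i) hγ hsize).2.trans hL4⟩
  obtain ⟨hST1, hΛ₁0, hΛ₁le⟩ := hST 1 (by norm_num)
  obtain ⟨hSTh, hΛh0, hΛhle⟩ := hST (1 / 2) (by rw [abs_of_nonneg (by norm_num : (0 : ℝ) ≤ 1 / 2)]; norm_num)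
  obtain ⟨hSTm, hΛm0, hΛmle⟩ := hST (-1) (by norm_num)
  have hb0 := l2bd_entry0_of_sup (R₀ := R₀ i) (H₀ := H₀ i) (hgeo i) hC0 hST1 hm0 (hsymGG i U)
  have hm1' : HasMajorantHom (g := toB6 (geo i) (R₀ i) (H₀ i)) (𝔬 i).blk (𝔬 i).blkY ((𝔬 i).D U ∘ₗ (𝔬 i).GG U)
      (fun (a b : (geo i).Site) => Csup * (geo i).len a * Real.exp (-(ρ' * (geo i).dist a b))) :=
    hasMajorantHom_mono (g := toB6 (geo i) (R₀ i) (H₀ i)) (𝔬 i).blk (𝔬 i).blkY hm1 fun a b =>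
      mul_le_mul_of_nonneg_right (mul_le_mul_of_nonneg_right hDle (hlen a)) (Real.exp_nonneg _)
  have hm2' : HasMajorantHom (g := toB6 (geo i) (R₀ i) (H₀ i)) (𝔬 i).blkY (𝔬 i).blk ((𝔬 i).GG U ∘ₗ (𝔬 i).Dstar U)
      (fun (a b : (geo i).Site) => Csup * (geo i).len a * Real.exp (-(ρ' * (geo i).dist a b))) :=
    hasMajorantHom_mono (g := toB6 (geo i) (R₀ i) (H₀ i)) (𝔬 i).blkY (𝔬 i).blk hm2 fun a b =>
      mul_le_mul_of_nonneg_right (mul_le_mul_of_nonneg_right hCle (hlen a)) (Real.exp_nonneg _)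
  obtain ⟨hb1, hb2⟩ := l2bd_entry12_of_sup (R₀ := R₀ i) (H₀ := H₀ i) (hgeo i) hCsup0 hSTh hm1' hm2' (htrGG i U)
  have hexp : ∀ y y' : (geo i).Site, Real.exp (-((1 - α) * ρ' * (geo i).dist y y')) ≤ Real.exp (-(δout * (geo i).dist y y')) :=
    fun y y' => Real.exp_le_exp.mpr (neg_le_neg (mul_le_mul_of_nonneg_right hδρ1 ((S i).dist_nonneg y y')))
  have hKL0 : 0 ≤ K6 := mul_nonneg (add_nonneg hCsup0 hKGu0) hΛu0
  have hK6C : Csup * Λu ≤ K6 := mul_le_mul_of_nonneg_right (le_add_of_nonneg_right hKGu0) hΛu0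
  have hK6G : KGu * Λu ≤ K6 := mul_le_mul_of_nonneg_right (le_add_of_nonneg_left hCsup0) hΛu0
  have hK0le : const313 (B₀ * (1 - θ * c)⁻¹) (B₃ * (1 - θ * c)⁻¹) B₃ c * (geo i).L ^ |(1 : ℝ)| ≤ K6 :=
    (mul_le_mul hCle hΛ₁le hΛ₁0 hCsup0).trans hK6C
  have hKhle : Csup * (geo i).L ^ |(1 / 2 : ℝ)| ≤ K6 := (mul_le_mul_of_nonneg_left hΛhle hCsup0).trans hK6C
  have hP : ∀ t : ℝ, B9.pref6 t 0 = t ^ 2 ∧ B9.pref6 t 1 = t ∧ B9.pref6 t 2 = t := fun t => by simp [B9.pref6]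
  have hB0 : BlockBd (g := toB6 (geo i) (R₀ i) (H₀ i)) (𝔬 i).blk (𝔬 i).blk ((𝔬 i).GG U)
      (fun (y y' : (geo i).Site) => K6 * B9.pref6 ((geo i).len y) 0 * Real.exp (-(δout * (geo i).dist y y'))) := by
    refine hb0.mono fun y y' => ?_
    rw [(hP ((geo i).len y)).1]
    calc const313 (B₀ * (1 - θ * c)⁻¹) (B₃ * (1 - θ * c)⁻¹) B₃ c * (geo i).L ^ |(1 : ℝ)| * (geo i).len y ^ 2 *
          Real.exp (-((1 - α) * ρ' * (geo i).dist y y'))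
        ≤ K6 * (geo i).len y ^ 2 * Real.exp (-((1 - α) * ρ' * (geo i).dist y y')) :=
          mul_le_mul_of_nonneg_right (mul_le_mul_of_nonneg_right hK0le (sq_nonneg _)) (Real.exp_nonneg _)
      _ ≤ K6 * (geo i).len y ^ 2 * Real.exp (-(δout * (geo i).dist y y')) :=
          mul_le_mul_of_nonneg_left (hexp y y') (mul_nonneg hKL0 (sq_nonneg _))
  have hB1 : BlockBd (g := toB6 (geo i) (R₀ i) (H₀ i)) (𝔬 i).blk (𝔬 i).blkY ((𝔬 i).D U ∘ₗ (𝔬 i).GG U)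
      (fun (y y' : (geo i).Site) => K6 * B9.pref6 ((geo i).len y) 1 * Real.exp (-(δout * (geo i).dist y y'))) := by
    refine hb1.mono fun y y' => ?_
    rw [(hP ((geo i).len y)).2.1]
    calc Csup * (geo i).L ^ |(1 / 2 : ℝ)| * (geo i).len y * Real.exp (-((1 - α) * ρ' * (geo i).dist y y'))
        ≤ K6 * (geo i).len y * Real.exp (-((1 - α) * ρ' * (geo i).dist y y')) :=
          mul_le_mul_of_nonneg_right (mul_le_mul_of_nonneg_right hKhle (hlen y)) (Real.exp_nonneg _)
      _ ≤ K6 * (geo i).len y * Real.exp (-(δout * (geo i).dist y y')) :=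
          mul_le_mul_of_nonneg_left (hexp y y') (mul_nonneg hKL0 (hlen y))
  have hB2 : BlockBd (g := toB6 (geo i) (R₀ i) (H₀ i)) (𝔬 i).blkY (𝔬 i).blk ((𝔬 i).GG U ∘ₗ (𝔬 i).Dstar U)
      (fun (y y' : (geo i).Site) => K6 * B9.pref6 ((geo i).len y) 2 * Real.exp (-(δout * (geo i).dist y y'))) := by
    refine hb2.mono fun y y' => ?_
    rw [(hP ((geo i).len y)).2.2]
    calc Csup * (geo i).L ^ |(1 / 2 : ℝ)| * (geo i).len y * Real.exp (-((1 - α) * ρ' * (geo i).dist y y'))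
        ≤ K6 * (geo i).len y * Real.exp (-((1 - α) * ρ' * (geo i).dist y y')) :=
          mul_le_mul_of_nonneg_right (mul_le_mul_of_nonneg_right hKhle (hlen y)) (Real.exp_nonneg _)
      _ ≤ K6 * (geo i).len y * Real.exp (-(δout * (geo i).dist y y')) :=
          mul_le_mul_of_nonneg_left (hexp y y') (mul_nonneg hKL0 (hlen y))
  -- the block-L² lines (3.46)₃,₄,₅ of 𝔊 by (3.153) in r1-g6's weighted block-L² classes (`B9Thm313WholeL2G`), inputs at the rate ρ
  have hρK : ρ ≤ δK := (le_add_of_nonneg_right hσ).trans hρδ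
  have hL2c : Thm33G0L2 (𝔬 i) (Lap i) (R₀ i) (H₀ i) B₂ ρ U := thm33G0L2_mono (hgeo i) hB₂ hρS hL2s
  have hTc : BlockBd (g := toB6 (geo i) (R₀ i) (H₀ i)) (𝔬 i).blk (𝔬 i).blk ((𝔬 i).Tpi U + (𝔬 i).T2 U)
      (fun (y y' : (geo i).Site) => θ₂' * ((geo i).len y)⁻¹ * ((geo i).len y')⁻¹ * Real.exp (-(ρ * (geo i).dist y y'))) :=
    hStL.t1.mono fun y y' => mul_le_mul_of_nonneg_left
      (Real.exp_le_exp.mpr (neg_le_neg (mul_le_mul_of_nonneg_right hρK ((S i).dist_nonneg y y'))))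
      (mul_nonneg (mul_nonneg hθ₂' (inv_nonneg.mpr (hlen y))) (inv_nonneg.mpr (hlen y')))
  have hLtc : Letters313L2 (𝔬 i) (Lap i) (R₀ i) (H₀ i) B₄ ρ U := letters313L2_mono (hgeo i) hB₄ hρ₃ hLt
  have h1Λu : (1 : ℝ) ≤ Λu := Real.one_le_rpow ((hL1 i).trans (hLle i)) (by norm_num)
  obtain ⟨hB3, hB4, hB5⟩ := lines345_GG (hgeo i) hrowi hB₂ hB₄ hc hθ₂' hθ₂'le hρ' hσ hρ'ρ₅ hq₂ hST1 hSTm hΛ₁0 hΛ₁le hΛm0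
    hΛmle h1Λu hKGu0 le_rfl hK6G hKL0 hδρ1 hδρ hL2c hTc hLtc hI
  -- all six lines, relative reading, then (Bout, δout)
  have hl2B6 : L2Block (GG i) ((m : ℝ) * m * K6) δout U :=
    l2Block_of_blockBds_rel (hRlen i) (hRdist i) (hRdist' i) (hmult i) hKL0 hlen hB0 hB1 hB2 hB3 hB4 hB5 hlR0 hlR1 hlR2 hlR3
      hlR4 hlR5
  have hl2B : L2Block (GG i) Bout δout U := fun n lam h y y' hcut hs =>
    weaken5 (hl2B6 n lam h y y' hcut hs) hBoutL hBout0 (pref6_nonneg (hlen y) n) ((S i).cutSup_nonneg h) ((S i).l2Norm_nonneg lam)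
      le_rfl ((S i).dist_nonneg y y')
  -- the (3.43) line of 𝔊 from the two probe majorants of (3.153) and the relative probe co-reading
  set θH' : ℝ := θH * ((geo i).M * α₀) with hθH'def
  have hθH' : 0 ≤ θH' := mul_nonneg hθH (mul_pos hMpos hα₀).le
  have hθH'le : θH' ≤ tH := mul_le_mul_of_nonneg_left hma₁ hθH
  have hκi : (bH i).κ ≤ max κ₀ 1 := (hκ i).trans (le_max_left _ _)
  have h1κ : (1 : ℝ) ≤ max κ₀ 1 := le_max_right _ _
  have hCuL : ∀ β, 0 ≤ β → β < 1 →
      constH313 (Bh β + θH' * (B₀ * (1 - θ * c)⁻¹) * c) θH' (B₀ * (1 - θ * c)⁻¹) (B₃ * (1 - θ * c)⁻¹) B₃ (BhD β) (Bq β) (bH i).κ c ≤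
        Cu β := by
    intro β h0 h1
    have hCL : Bh β + θH' * (B₀ * (1 - θ * c)⁻¹) * c ≤ Bh β + tH * (2 * B₀) * c := by
      have := mul_le_mul_of_nonneg_right (mul_le_mul hθH'le hA₁le hA₁ htH0) hc; linarith only [this]
    exact constH313_mono'' hCL hθH' hθH'le hA₁ hA₁le hA₃ hA₃le hB₃ (hBhD β h0 h1) (le_max_left _ _) (hBq β h0 h1) (le_max_left _ _)
      (bH i).κ_nonneg hκi hc
  have hCuR : ∀ β, 0 ≤ β → β < 1 →
      constH313 (Bh β + θH' * (B₀ * (1 - θ * c)⁻¹) * c) θH' (B₀ * (1 - θ * c)⁻¹) (B₃ * (1 - θ * c)⁻¹) B₃ (Bx β) (Bx β) 1 c ≤ Cu β := by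
    intro β h0 h1
    have hCL : Bh β + θH' * (B₀ * (1 - θ * c)⁻¹) * c ≤ Bh β + tH * (2 * B₀) * c := by
      have := mul_le_mul_of_nonneg_right (mul_le_mul hθH'le hA₁le hA₁ htH0) hc; linarith only [this]
    exact constH313_mono'' hCL hθH' hθH'le hA₁ hA₁le hA₃ hA₃le hB₃ (hBx β h0 h1) (le_max_right _ _) (hBx β h0 h1) (le_max_right _ _)
      zero_le_one h1κ hc
  have hCu0 : ∀ β, 0 ≤ β → β < 1 → 0 ≤ Cu β := fun β h0 h1 =>
    (constH313_nonneg (add_nonneg (hBh β h0 h1) (mul_nonneg (mul_nonneg hθH' hA₁) hc)) hθH' hA₁ hA₃ hB₃ (hBx β h0 h1) (hBx β h0 h1)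
      zero_le_one hc).trans (hCuR β h0 h1)
  have hL43 : ∀ β, 0 ≤ β → β < 1 → HasMajorantHom (g := toB6 (geo i) (R₀ i) (H₀ i)) (𝔬 i).blk (𝔭 i).blkPY
      ((𝔭 i).ΦY U β ∘ₗ ((𝔬 i).D U ∘ₗ (𝔬 i).GG U))
      (fun (a b : (geo i).Site) => Cu β * (geo i).len a ^ (1 - β) * Real.exp (-(ρ' * (geo i).dist a b))) := by
    intro β h0 h1
    have h := GG_probe43L_of_letters (hgeo i) (𝔭 i) hrowi hc hθ hθH' hB₀ hB₃ (hBh β h0 h1) (hBq β h0 h1) (hBhD β h0 h1) hσ hρ'.le hρ'ρ hρS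
      hρ₃ hρδ hq1 hS2.step1 h33.e0 (hH0.h43L β h0 h1) (hStH.pY1 β h0 h1) (hHH.pQ β h0 h1) (hH3.pYDH β h0 h1) hL hLD.rgdH hI
    exact hasMajorantHom_mono (g := toB6 (geo i) (R₀ i) (H₀ i)) (𝔬 i).blk (𝔭 i).blkPY h fun a b =>
      mul_le_mul_of_nonneg_right (mul_le_mul_of_nonneg_right (hCuL β h0 h1) (Real.rpow_nonneg (hlen a) _)) (Real.exp_nonneg _)
  have hR43 : ∀ β, 0 ≤ β → β < 1 → HasMajorantHom (g := toB6 (geo i) (R₀ i) (H₀ i)) (𝔬 i).blkY (𝔭 i).blkPX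
      ((𝔭 i).ΦX U β ∘ₗ ((𝔬 i).GG U ∘ₗ (𝔬 i).Dstar U))
      (fun (a b : (geo i).Site) => Cu β * (geo i).len a ^ (1 - β) * Real.exp (-(ρ' * (geo i).dist a b))) := by
    intro β h0 h1
    have h := GG_probe43R_of_letters (hgeo i) (𝔭 i) hrowi hc hθ hθH' hB₀ hB₃ (hBh β h0 h1) (hBx β h0 h1) hσ hρ'.le hρ'ρ hρS hρ₃ hρδ hq1
      hS1.step1 h33.e2 (hH0.h43R β h0 h1) (hStH.pX1 β h0 h1) (hH3.pXDv β h0 h1) (hH3.pXQs β h0 h1) hL hI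
    exact hasMajorantHom_mono (g := toB6 (geo i) (R₀ i) (H₀ i)) (𝔬 i).blkY (𝔭 i).blkPX h fun a b =>
      mul_le_mul_of_nonneg_right (mul_le_mul_of_nonneg_right (hCuR β h0 h1) (Real.rpow_nonneg (hlen a) _)) (Real.exp_nonneg _)
  have h343 : H1Block (GG i) (fun β => m * Cu β) ρ' U :=
    line343_of_hasMajorantHom_rel (R := R₀ i) (H := H₀ i) hH1 (hRlen i) (hRdist i) (hRdist' i) (hmult i) hCu0 hlen hL43 hR43
  have hβle : ∀ β, (m : ℝ) * Cu β ≤ Bβo β := fun β => le_max_left _ _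
  exact ⟨⟨eNoLap_of_clauses (w cl0) (w cl1) (w cl2), hl2B, hglob⟩,
    ⟨h1Block_mono (S i) h343 hβle hBβo0 hδρ, e4Block_mono (S i) h344 (fun _ => le_rfl) hBε hδδ₁,
      h2Block_mono (S i) h345 (fun _ _ => le_rfl) hBεβ hδδ₁⟩,
    hasRWExp_of_schemas (hgeo i) hrowi hθ hσδ hq1 hS2 hI (GG i) δout, posDefK_of_schemas hr hF hI (GG i)⟩

end Family

end

end Literature.MathematicalPhysics.QuantumFieldTheory.Balaban1983to89.B9Thm313WholeLeafRelSHL
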